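import Summits.BirchSwinnertonDyer.BirchSwinnertonDyer.Theorems.PrintCFramBottomClassIndexLawFiveLeBorelKolyvaginVisibility
import Summits.BirchSwinnertonDyer.BirchSwinnertonDyer.Theorems.PrintCFramBottomClassIndexLawFiveLeBorelH1VanishingMachineForm
import HarnessLib

/-!
# Route `PrintCFram`, crux C2 `BottomClassIndexLawFiveLe` (stmt-BirchSwinnertonDyer-20372), line
# `eisenstein-resource-bdp-line` (stub `stub_kolyvaginUpper_borelCM_pairSum_offKrizLi`, input (γ)):
# **THE VISIBILITY TRICHOTOMY AT THE BOREL CM-RAMIFIED PRIME** — a non-zero eigenclass is killed by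
# the Frobenius of EVERY Kolyvagin prime iff its values lie on the line `W[𝔭]` AND its sign is
# `−η_line`; every other class is seen
# (cell `bsd-print-cfram`, seat `bsd-line-cfram-p1-w2` g6; helper `--supports` 20372; 0 facts, 0 defs)

HONEST FRAMING. Nothing about BSD is proved here, and nothing of the stub itself. On the leaf
(`W` CM, `p ≥ 5` CM-ramified, `𝓞_𝔭`-structure `μ = √−p` from `exists_sqrt_end_of_cmRamified`), over
an imaginary quadratic `K` with complex conjugation `σ` lifted to `τ` along `c₀ ∈ Γ_ℚ`, for a
`σ_*`-eigenclass `x ∈ H¹(K, W[p^M])` of sign `ν = ±1`: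
* `forall_h1Eval_conjGalCMH_mul_eq_zero_of_line_of_lineSign` — if every value `[x, g]`
  (`g ∈ Γ_{K(W[p^M])}`) lies on the line `W[𝔭]` (`μ θ⁻¹[x, g] = 0`: `𝓞`-DEPTH ONE) and complex
  conjugation acts on `W[𝔭]` by `−ν` (`η_line = −ν`), then `[x, g^τ g] = 0` for EVERY `g`:
  the class is INVISIBLE to Kolyvagin primes (and locally trivial at each of them,
  `mem_torsionLocalKer_of_line_of_lineSign`);
* `exists_h1Eval_conjGalCMH_mul_ne_zero_of_offLine` — if SOME value lies off the line (depth `≥ 2`),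
  some `[x, g^τ g] ≠ 0` (uniserial values `⊇ W[𝔭²] = W[p]`, on which `τ` is not a scalar);
* `exists_h1Eval_conjGalCMH_mul_ne_zero_of_line_of_lineSign_eq` — depth one and `η_line = ν`,
  `x ≠ 0`: some `[x, g^τ g] = 2[x, g] ≠ 0` ((α) on the class);
* `forall_h1Eval_conjGalCMH_mul_eq_zero_iff_of_cmRamified` — the CRITERION for `x ≠ 0`:
  invisible **iff** (depth one) ∧ (`η_line = −ν`).
So the classes Kolyvagin's Čebotarev step cannot reach on the Borel class are EXACTLY the images of
`H¹(K, W[𝔭])` of the wrong sign — H1check §3 and LEAD g7's «Kolyvagin blind to the wrong-sign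
eigenline», as kernel theorems; together with FILE 1 (`…BorelKernelCebotarev`: the kernel-form
Čebotarev from any intertwining realiser) this is the complete image-side dictionary of the
machine at the Borel prime. THEOREMS ONLY; no definition, no named fact, no `sorry`. BSD is not
proved by any of this; no summit statement is proved by this seat.
References: [McCallumLMS1991] §3 (2)–(3); [GrossLMS1991] §9; crux `Lines/borel-heegner-squeeze-H1check.md` §3.
-/

set_option autoImplicit false
-- `…BirchSwinnertonDyer.BirchSwinnertonDyer.Theorems…` is the problem's mandated namespace (D-0017).
set_option linter.dupNamespace false

noncomputable section

open scoped Classical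

namespace Summit.BirchSwinnertonDyer.BirchSwinnertonDyer.Theorems.PrintCFram.BorelKolyvaginPairing

open WeierstrassCurve NumberField IsDedekindDomain Field Literature.NumberTheory.EllipticCurves
  Literature.NumberTheory.GaloisRepresentations Literature.NumberTheory.EllipticCurves.Rank1Residual
  Summit.BirchSwinnertonDyer.BirchSwinnertonDyer.Theorems.PrintCFram.BorelHomothety

variable (W : WeierstrassCurve ℚ) [W.IsElliptic] (p : ℕ) [hp : Fact p.Prime]
variable {K : Type} [Field K] [NumberField K]
variable {σ : K ≃ₐ[ℚ] K} {τ : AlgebraicClosure K ≃+* AlgebraicClosure K} {c₀ : absoluteGaloisGroup ℚ}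

/-! ## §1 Invisible: depth one and sign `−η_line` -/

omit [W.IsElliptic] hp in
/-- **INVISIBLE classes on the class (depth one, wrong sign).** If every value `[x, g]` of the
`σ_*`-eigenclass `x` (sign `ν = ±1`) lies on the line `W[𝔭] = ker μ` and complex conjugation acts
on that line by `−ν` (`η_line = −ν`), then `[x, g^τ g] = 0` for EVERY `g ∈ Γ_{K(W[n])}`. (Generic in
the curve: only the transport `τ = e c₀ e⁻¹` and the sign on `ker μ` are used.)
[cite: McCallumLMS1991, §3 (2)–(3)] -/
theorem forall_h1Eval_conjGalCMH_mul_eq_zero_of_line_of_lineSign (hτ : IsLiftOfAut σ τ)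
    (hγ : ∀ x, τ x = absGaloisTransport (K := ℚ) (L := K) c₀ x) (hinv : ∀ x, τ (τ x) = x)
    {μ : AddMonoid.End W.geomPoints} (n : ℤ) {x : galH1Torsion (W.baseChange K) n} {ν : ℤ}
    (hν : ν = 1 ∨ ν = -1) (hx : conjAct W σ n x = ν • x)
    (hline : ∀ g ∈ torsionFixing (W.baseChange K) n,
      μ ((RatClosure.torsionEquiv (K := K) W n).symm (h1Eval (W.baseChange K) n x g) :
        W.geomTorsion n) = 0)
    (hη : ∀ P : W.geomPoints, μ P = 0 → c₀ • P = -(ν • P))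
    {g : absoluteGaloisGroup K} (hg : g ∈ torsionFixing (W.baseChange K) n) :
    h1Eval (W.baseChange K) n x (hτ.conjGalCMH g * g) = 0 := by
  refine h1Eval_conjGalCMH_mul_eq_zero_of_antiEigen W hτ hinv n hν hx (fun g' hg' ↦ ?_) hg
  rw [torsionMap_eq_lineSign_smul W hτ hγ (η := -ν) (fun P hP ↦ by rw [hη P hP, neg_smul]) n
    _ (hline g' hg'), neg_smul]

/-- **… hence locally trivial at every Kolyvagin-type place** (Frobenius a `Γ_K`-conjugate of some
`g^τ g`; the tree's local criterion). [cite: McCallumLMS1991, §3 (3)] [cite: GrossLMS1991, Prop. 9.6] -/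
theorem mem_torsionLocalKer_of_line_of_lineSign (hτ : IsLiftOfAut σ τ)
    (hγ : ∀ x, τ x = absGaloisTransport (K := ℚ) (L := K) c₀ x) (hinv : ∀ x, τ (τ x) = x)
    {μ : AddMonoid.End W.geomPoints} {n : ℤ} (hn : n ≠ 0) {x : galH1Torsion (W.baseChange K) n}
    {ν : ℤ} (hν : ν = 1 ∨ ν = -1) (hx : conjAct W σ n x = ν • x)
    (hline : ∀ g ∈ torsionFixing (W.baseChange K) n,
      μ ((RatClosure.torsionEquiv (K := K) W n).symm (h1Eval (W.baseChange K) n x g) :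
        W.geomTorsion n) = 0)
    (hη : ∀ P : W.geomPoints, μ P = 0 → c₀ • P = -(ν • P))
    {v : HeightOneSpectrum (𝓞 K)} {𝔐 : Ideal (HeightOneSpectrum.localAbsIntegers v)}
    (h𝔐 : 𝔐 ∈ v.localPrimesAbove) {F δ g : absoluteGaloisGroup K}
    (hF : IsArithFrobAt (𝓞 K) F (v.primeBelow (closureEmb (K := K) (v.adicCompletion K)) 𝔐))
    (hg : g ∈ torsionFixing (W.baseChange K) n) (hFg : F = δ * (hτ.conjGalCMH g * g) * δ⁻¹)
    (hI : (v.primeBelow (closureEmb (K := K) (v.adicCompletion K)) 𝔐).inertia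
      (absoluteGaloisGroup K) ≤ torsionFixing (W.baseChange K) n)
    (hsurj : Function.Surjective (torsionPointsMap (W.baseChange K) (v.adicCompletion K) n))
    (hxunr : x ∈ unramifiedKer (geomTorsion (W.baseChange K) n)
      (v.primeBelow (closureEmb (K := K) (v.adicCompletion K)) 𝔐)) :
    x ∈ (W.baseChange K).torsionLocalKer (v.adicCompletion K) n :=
  mem_torsionLocalKer_of_antiEigen W hτ hinv hn hν hx (fun g' hg' ↦ by
    rw [torsionMap_eq_lineSign_smul W hτ hγ (η := -ν) (fun P hP ↦ by rw [hη P hP, neg_smul]) n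
      _ (hline g' hg'), neg_smul]) h𝔐 hF hg hFg hI hsurj hxunr

/-! ## §2 Visible: some value off the line (depth `≥ 2`) -/

/-- **VISIBLE classes: a value off the line.** On the leaf (`W` CM, `5 ≤ p` CM-ramified, `μ`
commuting with the `√−p`-fixing elements and anti-commuting with the rest), over `K` with
`[K : ℚ] < p`, `M ≥ 1`: if SOME value `[x, g₀]` of the `σ_*`-eigenclass `x` (sign `ν = ±1`) lies
OFF the line `W[𝔭]`, then `[x, g^τ g] ≠ 0` for SOME `g ∈ Γ_{K(W[p^M])}`. Proof: the values of `x`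
form a `Γ_K`-stable subgroup, hence a layer `W[𝔭^k]` (uniserial tower); `k ≥ 2`, so the values
contain `W[𝔭²] = W[p]`, on which `τ` is not the scalar `−ν`. [cite: McCallumLMS1991, §3 (2)–(3)] -/
theorem exists_h1Eval_conjGalCMH_mul_ne_zero_of_offLine (hCM : W.HasCM) (h5 : 5 ≤ p)
    (hram : CMRamified W p) {s : AlgebraicClosure ℚ} {μ : AddMonoid.End W.geomPoints} {m : ℤ}
    (hs : s ^ 2 = ((-(p : ℤ) : ℤ) : AlgebraicClosure ℚ)) (hm : m.natAbs = p)
    (hμμ : ∀ P, μ (μ P) = m • P)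
    (hcomm : ∀ g : absoluteGaloisGroup ℚ, g • s = s → ∀ P, μ (g • P) = g • μ P)
    (hanti : ∀ g : absoluteGaloisGroup ℚ, g • s = -s → ∀ P, μ (g • P) = -(g • μ P))
    (hK : Module.finrank ℚ K < p) (hτ : IsLiftOfAut σ τ)
    (hγ : ∀ x, τ x = absGaloisTransport (K := ℚ) (L := K) c₀ x) (hinv : ∀ x, τ (τ x) = x)
    (hc₀ : IsComplexConjugation (Rat.castHom ℝ) c₀) {M : ℕ} (hM : 1 ≤ M)
    {x : galH1Torsion (W.baseChange K) ((p ^ M : ℕ) : ℤ)} {ν : ℤ} (hν : ν = 1 ∨ ν = -1)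
    (hx : conjAct W σ ((p ^ M : ℕ) : ℤ) x = ν • x) {g₀ : absoluteGaloisGroup K}
    (hg₀ : g₀ ∈ torsionFixing (W.baseChange K) ((p ^ M : ℕ) : ℤ))
    (hoff : μ ((RatClosure.torsionEquiv (K := K) W ((p ^ M : ℕ) : ℤ)).symm
      (h1Eval (W.baseChange K) ((p ^ M : ℕ) : ℤ) x g₀) : W.geomTorsion ((p ^ M : ℕ) : ℤ)) ≠ 0) :
    ∃ g ∈ torsionFixing (W.baseChange K) ((p ^ M : ℕ) : ℤ),
      h1Eval (W.baseChange K) ((p ^ M : ℕ) : ℤ) x (hτ.conjGalCMH g * g) ≠ 0 := by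
  have hpr : p.Prime := hp.out
  have hp2 : p ≠ 2 := by omega
  -- the subgroup of values of `x`
  let H : AddSubgroup (geomTorsion (W.baseChange K) ((p ^ M : ℕ) : ℤ)) :=
    { carrier := {t | ∃ g ∈ torsionFixing (W.baseChange K) ((p ^ M : ℕ) : ℤ),
        h1Eval (W.baseChange K) ((p ^ M : ℕ) : ℤ) x g = t}
      zero_mem' := ⟨1, one_mem _, h1Eval_one (W.baseChange K) _ x⟩
      add_mem' := by
        rintro t t' ⟨g, hg, rfl⟩ ⟨g', hg', rfl⟩
        exact ⟨g * g', mul_mem hg hg', h1Eval_mul (W.baseChange K) _ x hg g'⟩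
      neg_mem' := by
        rintro t ⟨g, hg, rfl⟩
        exact ⟨g⁻¹, inv_mem hg, h1Eval_inv (W.baseChange K) _ x hg⟩ }
  have hmemH : ∀ t, t ∈ H ↔ ∃ g ∈ torsionFixing (W.baseChange K) ((p ^ M : ℕ) : ℤ),
      h1Eval (W.baseChange K) ((p ^ M : ℕ) : ℤ) x g = t := fun _ ↦ Iff.rfl
  have hH : ∀ γ : absoluteGaloisGroup K, ∀ t ∈ H, γ • t ∈ H := by
    rintro γ t ⟨g, hg, rfl⟩
    exact ⟨γ * g * γ⁻¹, (torsionFixing_normal (W.baseChange K) _).conj_mem g hg γ,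
      h1Eval_conj (W.baseChange K) _ x γ hg⟩
  obtain ⟨k, -, hk⟩ := exists_forall_mem_iff_pow_apply_eq_zero_baseChange_of_cmRamified W p K hCM
    h5 hram hs hm hμμ hcomm hK hM H hH
  -- `k ≥ 2` since `[x, g₀] ∈ H` lies off the line
  have hk2 : 2 ≤ k := by
    by_contra hlt
    have hmem : h1Eval (W.baseChange K) ((p ^ M : ℕ) : ℤ) x g₀ ∈ H := ⟨g₀, hg₀, rfl⟩
    rw [hk] at hmem
    interval_cases k
    · apply hoff
      have h0 : (((RatClosure.torsionEquiv (K := K) W ((p ^ M : ℕ) : ℤ)).symm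
          (h1Eval (W.baseChange K) ((p ^ M : ℕ) : ℤ) x g₀) : W.geomTorsion ((p ^ M : ℕ) : ℤ)) :
          W.geomPoints) = 0 := by
        simpa only [pow_zero, AddMonoid.End.coe_one, id_eq] using hmem
      rw [h0, map_zero]
    · apply hoff
      simpa only [pow_one] using hmem
  -- a `p`-torsion `t` with `τ t ≠ -ν t`; it is a value
  obtain ⟨t, ht2, htν⟩ := exists_torsionMap_ne_neg_smul_of_layer_two W p hτ hγ hc₀ hs hm hμμ
    hanti hp2 hM hν
  have htH : t ∈ H := by
    rw [hk]
    obtain ⟨j, rfl⟩ := Nat.exists_eq_add_of_le hk2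
    rw [add_comm, pow_add, AddMonoid.End.coe_mul, Function.comp_apply, ht2, map_zero]
  obtain ⟨g, hg, hgt⟩ := (hmemH t).mp htH
  refine ⟨g, hg, h1Eval_conjGalCMH_mul_ne_zero_of_not_antiEigen W hτ hinv _ hν hx hg ?_⟩
  rw [hgt]
  exact htν

/-! ## §3 Visible: depth one and sign `η_line` -/

/-- **VISIBLE classes: depth one, matching sign.** On the leaf, over a quadratic `K`, `M ≥ 1`: if
every value of the non-zero `σ_*`-eigenclass `x` (sign `ν = ±1`) lies on `W[𝔭]` and complex
conjugation acts on `W[𝔭]` by `ν` (`η_line = ν`), then `[x, g^τ g] ≠ 0` for some `g` — indeed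
`[x, g^τ g] = 2[x, g]`, and some `[x, g] ≠ 0` by restriction-injectivity on the class ((α),
`eq_zero_of_forall_h1Eval_eq_zero_of_cmRamified`). [cite: McCallumLMS1991, §3 (2)–(3)]
[cite: GrossLMS1991, Prop. 9.1] -/
theorem exists_h1Eval_conjGalCMH_mul_ne_zero_of_line_of_lineSign_eq (hCM : W.HasCM) (h5 : 5 ≤ p)
    (hram : CMRamified W p) {μ : AddMonoid.End W.geomPoints}
    (hK2 : Module.finrank ℚ K = 2) (hτ : IsLiftOfAut σ τ)
    (hγ : ∀ x, τ x = absGaloisTransport (K := ℚ) (L := K) c₀ x) (hinv : ∀ x, τ (τ x) = x)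
    {M : ℕ} (hM : 1 ≤ M) {x : galH1Torsion (W.baseChange K) ((p ^ M : ℕ) : ℤ)} (hx0 : x ≠ 0)
    {ν : ℤ} (hν : ν = 1 ∨ ν = -1) (hx : conjAct W σ ((p ^ M : ℕ) : ℤ) x = ν • x)
    (hline : ∀ g ∈ torsionFixing (W.baseChange K) ((p ^ M : ℕ) : ℤ),
      μ ((RatClosure.torsionEquiv (K := K) W ((p ^ M : ℕ) : ℤ)).symm
        (h1Eval (W.baseChange K) ((p ^ M : ℕ) : ℤ) x g) : W.geomTorsion ((p ^ M : ℕ) : ℤ)) = 0)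
    (hη : ∀ P : W.geomPoints, μ P = 0 → c₀ • P = ν • P) :
    ∃ g ∈ torsionFixing (W.baseChange K) ((p ^ M : ℕ) : ℤ),
      h1Eval (W.baseChange K) ((p ^ M : ℕ) : ℤ) x (hτ.conjGalCMH g * g) ≠ 0 := by
  have hpr : p.Prime := hp.out
  have hp2 : p ≠ 2 := by omega
  -- some non-zero value, by (α) on the class
  obtain ⟨g, hg, hgv⟩ : ∃ g ∈ torsionFixing (W.baseChange K) ((p ^ M : ℕ) : ℤ),
      h1Eval (W.baseChange K) ((p ^ M : ℕ) : ℤ) x g ≠ 0 := by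
    by_contra h
    push Not at h
    exact hx0 (eq_zero_of_forall_h1Eval_eq_zero_of_cmRamified W p K hCM h5 hram hK2 hM h)
  obtain ⟨u, hu⟩ := exists_two_mul_zsmul_eq_of_odd (W.baseChange K) (n := p ^ M)
    ((hpr.odd_of_ne_two hp2).pow)
  refine ⟨g, hg, h1Eval_conjGalCMH_mul_ne_zero_of_not_antiEigen W hτ hinv _ hν hx hg ?_⟩
  rw [torsionMap_eq_lineSign_smul W hτ hγ hη _ _ (hline g hg)]
  -- `ν v ≠ -(ν v)` for `v ≠ 0` (`2` invertible, `ν = ±1`)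
  intro h
  have h2 : (2 : ℤ) • (ν • h1Eval (W.baseChange K) ((p ^ M : ℕ) : ℤ) x g) = 0 := by
    rw [two_zsmul]; nth_rewrite 2 [h]; rw [add_neg_cancel]
  have h0 : ν • h1Eval (W.baseChange K) ((p ^ M : ℕ) : ℤ) x g = 0 := by
    rw [← hu (ν • _), mul_comm, mul_zsmul, h2, zsmul_zero]
  apply hgv
  rcases hν with rfl | rfl
  · rwa [one_smul] at h0
  · rwa [neg_one_zsmul, neg_eq_zero] at h0

/-! ## §4 The criterion -/

/-- **THE VISIBILITY CRITERION AT THE BOREL CM-RAMIFIED PRIME.** On the leaf (`W` CM, `5 ≤ p`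
CM-ramified, `𝓞_𝔭`-structure `μ`), over an imaginary QUADRATIC `K` with complex conjugation `σ`
lifted along `c₀`, `M ≥ 1`, for a NON-ZERO `σ_*`-eigenclass `x ∈ H¹(K, W[p^M])` of sign `ν = ±1`:
`[x, g^τ g] = 0` for every `g ∈ Γ_{K(W[p^M])}` (the class is killed by the Frobenius of every
Kolyvagin prime) **iff** every value `[x, g]` lies on the line `W[𝔭]` (`𝓞`-depth one) **and**
complex conjugation acts on `W[𝔭]` by `−ν` (`η_line(W) = −ν`). In particular exactly ONE of the two
eigen-signs carries invisible classes, and they all come from `H¹(K, W[𝔭])`; switching to the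
isogenous `W/W[𝔭]` flips `η_line` (w2 g5 `exists_lines_sign_flip_of_cmRamified`).
[cite: McCallumLMS1991, §3 (2)–(3)] [cite: GrossLMS1991, §9] -/
theorem forall_h1Eval_conjGalCMH_mul_eq_zero_iff_of_cmRamified (hCM : W.HasCM) (h5 : 5 ≤ p)
    (hram : CMRamified W p) {s : AlgebraicClosure ℚ} {μ : AddMonoid.End W.geomPoints} {m : ℤ}
    (hs : s ^ 2 = ((-(p : ℤ) : ℤ) : AlgebraicClosure ℚ)) (hm : m.natAbs = p)
    (hμμ : ∀ P, μ (μ P) = m • P)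
    (hcomm : ∀ g : absoluteGaloisGroup ℚ, g • s = s → ∀ P, μ (g • P) = g • μ P)
    (hanti : ∀ g : absoluteGaloisGroup ℚ, g • s = -s → ∀ P, μ (g • P) = -(g • μ P))
    (hK2 : Module.finrank ℚ K = 2) (hτ : IsLiftOfAut σ τ)
    (hγ : ∀ x, τ x = absGaloisTransport (K := ℚ) (L := K) c₀ x) (hinv : ∀ x, τ (τ x) = x)
    (hc₀ : IsComplexConjugation (Rat.castHom ℝ) c₀) {M : ℕ} (hM : 1 ≤ M)
    {x : galH1Torsion (W.baseChange K) ((p ^ M : ℕ) : ℤ)} (hx0 : x ≠ 0) {ν : ℤ}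
    (hν : ν = 1 ∨ ν = -1) (hx : conjAct W σ ((p ^ M : ℕ) : ℤ) x = ν • x) :
    (∀ g ∈ torsionFixing (W.baseChange K) ((p ^ M : ℕ) : ℤ),
        h1Eval (W.baseChange K) ((p ^ M : ℕ) : ℤ) x (hτ.conjGalCMH g * g) = 0) ↔
      (∀ g ∈ torsionFixing (W.baseChange K) ((p ^ M : ℕ) : ℤ),
        μ ((RatClosure.torsionEquiv (K := K) W ((p ^ M : ℕ) : ℤ)).symm
          (h1Eval (W.baseChange K) ((p ^ M : ℕ) : ℤ) x g) : W.geomTorsion ((p ^ M : ℕ) : ℤ)) = 0) ∧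
      ∀ P : W.geomPoints, μ P = 0 → c₀ • P = -(ν • P) := by
  have hK : Module.finrank ℚ K < p := by rw [hK2]; omega
  refine ⟨fun hall ↦ ?_, fun ⟨hline, hη⟩ g hg ↦
    forall_h1Eval_conjGalCMH_mul_eq_zero_of_line_of_lineSign W hτ hγ hinv _ hν hx hline hη hg⟩
  -- (i) every value on the line
  have hline : ∀ g ∈ torsionFixing (W.baseChange K) ((p ^ M : ℕ) : ℤ),
      μ ((RatClosure.torsionEquiv (K := K) W ((p ^ M : ℕ) : ℤ)).symm
        (h1Eval (W.baseChange K) ((p ^ M : ℕ) : ℤ) x g) : W.geomTorsion ((p ^ M : ℕ) : ℤ)) = 0 := by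
    intro g₀ hg₀
    by_contra hoff
    obtain ⟨g, hg, hne⟩ := exists_h1Eval_conjGalCMH_mul_ne_zero_of_offLine W p hCM h5 hram hs hm
      hμμ hcomm hanti hK hτ hγ hinv hc₀ hM hν hx hg₀ hoff
    exact hne (hall g hg)
  refine ⟨hline, ?_⟩
  -- (ii) the sign on the line is `-ν`
  obtain ⟨η, hη, hηP⟩ := exists_lineSign_of_isComplexConjugation W p hc₀ hs hm hμμ hanti
  by_cases hην : η = ν
  · subst hην
    obtain ⟨g, hg, hne⟩ := exists_h1Eval_conjGalCMH_mul_ne_zero_of_line_of_lineSign_eq W p hCM h5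
      hram hK2 hτ hγ hinv hM hx0 hν hx hline hηP
    exact absurd (hall g hg) hne
  · have hη' : η = -ν := by
      rcases hη with rfl | rfl <;> rcases hν with rfl | rfl <;> simp_all
    intro P hP
    rw [hηP P hP, hη', neg_smul]

end Summit.BirchSwinnertonDyer.BirchSwinnertonDyer.Theorems.PrintCFram.BorelKolyvaginPairing

end
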